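import Summits.HodgeConjecture.CorCM.IrreducibleOddWeightsShadowModules
import Mathlib.LinearAlgebra.Matrix.Dual
import Mathlib.LinearAlgebra.Dual.Lemmas
import HarnessLib

/-!
# Shadow modules, VI: ONE-SIDED QUANTISATION — the shadow-coefficient space of a shadow in an IRREDUCIBLE module has
# no proper non-zero right-stable subspace; against ANY partner the defect is `0` or `dim A₀` (absorption)

COR-CM (cell `pub-hodgecm2`, binder seat `b16` gen 69, count-neutral claim ROW SPACES OVER THE COMMUTANT, file Q7 —
abstract `G`-set level; theorems only, no definition, no named fact, no `sorry`).  NEW as stated, hence under `Summits/`.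
HONEST FRAMING: linear algebra of translates of functions on a finite `G`-set (duality for the dot product via Mathlib's
`dotProductEquiv` ∕ `dualCoannihilator`), with its consequence for the Kubota–Dodson rank of a pair of CM types through
gen 68's ONE-SIDED shadow formula (P1 `typeRank_add_typeRank_eq_add_finrank_shadowCoeff_inf_of_fine`); the partner slot
is ARBITRARY.  Gen 51's Goursat dichotomy (`PairFlipTransportDichotomy`, irreducible SLOT) is the case `T₀ = K₀`; here the
irreducible object is the module of the SHADOW on a pivot.  `HC_CM` is neither used nor asserted.

SETTING (Q3).  `G` acts on a finite set `Y₀`; `A ≤ ℚ^{Y₀}` stable and irreducible, `w ∈ A`; `S(w) = span{g ↦ w(g·y)}`,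
stable under RIGHT translations `c ↦ c(·k)` (`c_y(gk) = c_{k·y}(g)`).

* §1 `translate_shadowCoeff_mem` (right stability of `S(w)`); **`eq_bot_or_eq_of_rightStable`**: a right-stable
  subspace `N ≤ S(w)` is `0` or `S(w)` — `S(w) ≅ ℚ^{Y₀}/A^⊥ ≅ A^*` is irreducible (proof: the preimage `W` of `N` under
  `β ↦ Σ_y β(y) c_y` is stable; its dot-orthogonal inside `A` is a stable subspace of `A`, hence `0` — then `W = ℚ^{Y₀}` by
  the dimension formula and `A^{⊥⊥} = A` — or `A` — then `W ⊆ A^⊥ = ker`, i.e. `N = 0`).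
* §2 **ONE-SIDED QUANTISATION** (`finrank_span_shadowCoeff_inf_eq_zero_or_eq_of_rightStable`): for ANY right-stable
  `M ≤ ℚ^G` (e.g. the matrix-coefficient space `MC₁` of any partner type, `span_coeff_rightStable`),
  `dim(S(w) ∩ M) ∈ {0, dim A}`, the non-zero case iff `S(w) ≤ M` (ABSORPTION).
* §3 type ranks (`typeRank_add_typeRank_eq_or_eq_add_finrank_of_irreducible_left`): ONE slot whose shadow lies in a stable
  irreducible module, pivot refining the trace classes, partner slot arbitrary ⟹
  **`rank Φ₀ + rank Φ₁ − rank(Φ₀,Φ₁) − 1 ∈ {0, dim A}`**; `= dim A` iff `S(w₀) ≤ MC₁`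
  (`typeRank_add_typeRank_eq_add_finrank_iff_le_of_irreducible_left`).

## References

* [Gordon1999HodgeAVSurvey] B. B. Gordon, *A survey of the Hodge conjecture for abelian varieties*, §3 Theorem (Imai,
  Murty) with proof, 7.5–7.7, 9.4.3.
* [Serre1977] J.-P. Serre, *Linear Representations of Finite Groups*, GTM 42, §2.2, §2.6.
* [Lang2002] S. Lang, *Algebra*, 3rd ed., XIII §5 (duality), XVII §1.
-/

set_option autoImplicit false

noncomputable section

open scoped BigOperators Classical

universe u v v' v'' w

namespace Summit.HodgeConjecture.CorCM.IrrOdd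

open Literature.NumberTheory.ComplexMultiplication

variable {G : Type w} [Group G] {Y₀ : Type v'} [MulAction G Y₀] [Fintype Y₀] [DecidableEq Y₀]

/-! ### §1 `S(w)` has no proper non-zero right-stable subspace -/

omit [Fintype Y₀] [DecidableEq Y₀] in
/-- Right translates of shadow coefficients are shadow coefficients: `c_y(gk) = c_{k·y}(g)`; so `S(w)` is right-stable.
[cite: Serre1977, §2.2] -/
theorem translate_shadowCoeff_mem (w : Y₀ → ℚ) (k : G) {c : G → ℚ}
    (hc : c ∈ Submodule.span ℚ (Set.range fun y : Y₀ => fun g : G => w (g • y))) :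
    (fun g => c (g * k)) ∈ Submodule.span ℚ (Set.range fun y : Y₀ => fun g : G => w (g • y)) := by
  have hmap := (Submodule.map_span_le (LinearMap.funLeft ℚ ℚ (fun g : G => g * k))
    (Set.range fun y : Y₀ => fun g : G => w (g • y))
    (Submodule.span ℚ (Set.range fun y : Y₀ => fun g : G => w (g • y)))).2 (by
      rintro _ ⟨y, rfl⟩
      exact Submodule.subset_span ⟨k • y, funext fun g => by simp [LinearMap.funLeft_apply, mul_smul]⟩)
  exact hmap (Submodule.mem_map_of_mem hc)

/-- **`S(w)` IS IRREDUCIBLE FOR RIGHT TRANSLATIONS**: `A ≤ ℚ^{Y₀}` stable irreducible, `w ∈ A`; a subspace `N ≤ S(w)`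
stable under `c ↦ c(·k)` is `0` or all of `S(w)`.  (`S(w) ≅ ℚ^{Y₀}/A^⊥ ≅ A^*`; duality for the dot product on `ℚ^{Y₀}`.)
[cite: Serre1977, §2.2 and §2.6] [cite: Lang2002, XIII §5] -/
theorem eq_bot_or_eq_of_rightStable {A : Submodule ℚ (Y₀ → ℚ)}
    (hAst : ∀ (k : G) (a : Y₀ → ℚ), a ∈ A → (fun y => a (k • y)) ∈ A)
    (hirr : ∀ W : Submodule ℚ (Y₀ → ℚ), W ≤ A → W ≠ ⊥ →
      (∀ (k : G) (f : Y₀ → ℚ), f ∈ W → (fun y => f (k • y)) ∈ W) → W = A)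
    {w : Y₀ → ℚ} (hw : w ∈ A) {N : Submodule ℚ (G → ℚ)}
    (hN : N ≤ Submodule.span ℚ (Set.range fun y : Y₀ => fun g : G => w (g • y)))
    (hNst : ∀ (k : G) (c : G → ℚ), c ∈ N → (fun g => c (g * k)) ∈ N) :
    N = ⊥ ∨ N = Submodule.span ℚ (Set.range fun y : Y₀ => fun g : G => w (g • y)) := by
  by_cases hN0 : N = ⊥
  · exact Or.inl hN0
  right
  -- the combination map `Ψ β = Σ_y β(y) c_y`
  let Ψ : (Y₀ → ℚ) →ₗ[ℚ] (G → ℚ) :=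
    { toFun := fun β g => ∑ y, β y * w (g • y)
      map_add' := fun β β' => by
        funext g
        simp only [Pi.add_apply, add_mul, Finset.sum_add_distrib]
      map_smul' := fun t β => by
        funext g
        simp only [Pi.smul_apply, smul_eq_mul, RingHom.id_apply, Finset.mul_sum, mul_assoc] }
  have hΨ_apply : ∀ (β : Y₀ → ℚ) (g : G), Ψ β g = ∑ y, β y * w (g • y) := fun β g => rfl
  -- `range Ψ = S(w)`
  have hΨsingle : ∀ y : Y₀, Ψ (Pi.single y 1) = fun g : G => w (g • y) := fun y => by
    funext g
    rw [hΨ_apply]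
    simp [Pi.single_apply]
  have hrange : LinearMap.range Ψ = Submodule.span ℚ (Set.range fun y : Y₀ => fun g : G => w (g • y)) := by
    refine le_antisymm ?_ (Submodule.span_le.2 ?_)
    · rintro _ ⟨β, rfl⟩
      have hdec : β = ∑ y, β y • (Pi.single y (1 : ℚ) : Y₀ → ℚ) := by
        funext y'
        simp [Finset.sum_apply, Pi.single_apply]
      rw [hdec, map_sum]
      exact Submodule.sum_mem _ fun y _ => by
        rw [map_smul, hΨsingle]
        exact Submodule.smul_mem _ _ (Submodule.subset_span ⟨y, rfl⟩)
    · rintro _ ⟨y, rfl⟩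
      exact ⟨Pi.single y 1, hΨsingle y⟩
  -- equivariance: `Ψ (β ∘ (k⁻¹ • ·)) = (Ψ β)(· k)`
  have hΨeq : ∀ (k : G) (β : Y₀ → ℚ), Ψ (fun y => β (k⁻¹ • y)) = fun g => Ψ β (g * k) := fun k β => by
    funext g
    rw [hΨ_apply, hΨ_apply]
    refine Fintype.sum_equiv (MulAction.toPerm k⁻¹) _ _ fun y => ?_
    simp [MulAction.toPerm_apply, mul_smul, smul_inv_smul]
  -- the preimage `W` of `N`, stable
  set W : Submodule ℚ (Y₀ → ℚ) := N.comap Ψ with hWdef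
  have hWst : ∀ (k : G) (β : Y₀ → ℚ), β ∈ W → (fun y => β (k • y)) ∈ W := fun k β hβ => by
    change Ψ (fun y => β (k • y)) ∈ N
    have h := hΨeq k⁻¹ β
    rw [inv_inv] at h
    rw [h]
    exact hNst k⁻¹ _ hβ
  -- a non-zero element of `N` and its preimage
  obtain ⟨c, hcN, hc0⟩ := (Submodule.ne_bot_iff N).1 hN0
  obtain ⟨α, hα⟩ : c ∈ LinearMap.range Ψ := by rw [hrange]; exact hN hcN
  have hαW : α ∈ W := by change Ψ α ∈ N; rw [hα]; exact hcN
  -- the kernel of `Ψ` is the dot-orthogonal of `A` (translates of `w` span `A`)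
  have hw0 : w ≠ 0 := by
    rintro rfl
    apply hc0
    rw [← hα]
    funext g
    rw [hΨ_apply]
    simp
  have hMw := span_translate_eq_of_irreducible hAst hirr hw hw0
  -- duality through the dot product
  let e := dotProductEquiv ℚ Y₀
  have he : ∀ β f : Y₀ → ℚ, e β f = ∑ y, β y * f y := fun β f => rfl
  -- the orthogonal of `W` inside `A` is stable, hence `⊥` or `A`
  set Q : Submodule ℚ (Y₀ → ℚ) := (W.map (e : (Y₀ → ℚ) →ₗ[ℚ] Module.Dual ℚ (Y₀ → ℚ))).dualCoannihilator ⊓ A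
    with hQdef
  have hmemQ : ∀ f : Y₀ → ℚ, f ∈ (W.map (e : (Y₀ → ℚ) →ₗ[ℚ] Module.Dual ℚ (Y₀ → ℚ))).dualCoannihilator ↔
      ∀ β ∈ W, ∑ y, β y * f y = 0 := fun f => by
    rw [Submodule.mem_dualCoannihilator]
    constructor
    · intro h β hβ
      rw [← he]
      exact h _ ⟨β, hβ, rfl⟩
    · rintro h _ ⟨β, hβ, rfl⟩
      rw [LinearEquiv.coe_coe, he]
      exact h β hβ
  have hQst : ∀ (k : G) (f : Y₀ → ℚ), f ∈ Q → (fun y => f (k • y)) ∈ Q := fun k f hf => by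
    refine ⟨(hmemQ _).2 fun β hβ => ?_, hAst k f hf.2⟩
    have h := (hmemQ f).1 hf.1 (fun y => β (k⁻¹ • y)) (hWst k⁻¹ β hβ)
    rw [← h]
    refine Fintype.sum_equiv (MulAction.toPerm k) _ _ fun y => ?_
    simp [MulAction.toPerm_apply, inv_smul_smul]
  -- `Q ≠ A`: otherwise every `β ∈ W` is orthogonal to all translates of `w`, i.e. `Ψ β = 0`, contradicting `α ∈ W`
  have hQne : Q ≠ A := by
    intro hQA
    apply hc0
    rw [← hα]
    funext g
    rw [hΨ_apply]
    have hmem : (fun y => w (g • y)) ∈ Q := by rw [hQA]; exact hAst g w hw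
    simpa using (hmemQ _).1 hmem.1 α hαW
  have hQbot : Q = ⊥ := by
    by_contra hne
    exact hQne (hirr Q inf_le_right hne hQst)
  -- `ker Ψ`, mapped to the dual, is the annihilator of `A`; hence the coannihilator of `W.map e` lies in `A`
  have hker : ∀ β : Y₀ → ℚ, Ψ β = 0 ↔ ∀ f ∈ A, ∑ y, β y * f y = 0 := fun β => by
    constructor
    · intro h f hf
      rw [← hMw] at hf
      induction hf using Submodule.span_induction with
      | mem f hf =>
        obtain ⟨g, rfl⟩ := hf
        have := congrFun h g
        rwa [hΨ_apply] at this
      | zero => simp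
      | add f f' _ _ hf hf' => simp only [Pi.add_apply, mul_add, Finset.sum_add_distrib, hf, hf', add_zero]
      | smul t f _ hf => simp only [Pi.smul_apply, smul_eq_mul, mul_left_comm _ t, ← Finset.mul_sum, hf, mul_zero]
    · intro h
      funext g
      rw [hΨ_apply]
      exact h _ (hAst g w hw)
  have hcoann_le : (W.map (e : (Y₀ → ℚ) →ₗ[ℚ] Module.Dual ℚ (Y₀ → ℚ))).dualCoannihilator ≤ A := by
    -- `A.dualAnnihilator ≤ W.map e` (its preimage under `e` is `ker Ψ ≤ W`), then apply the antitone coannihilator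
    have hle : A.dualAnnihilator ≤ W.map (e : (Y₀ → ℚ) →ₗ[ℚ] Module.Dual ℚ (Y₀ → ℚ)) := by
      intro φ hφ
      refine ⟨e.symm φ, ?_, by simp⟩
      change Ψ (e.symm φ) ∈ N
      have h0 : Ψ (e.symm φ) = 0 := (hker _).2 fun f hf => by
        rw [← he, LinearEquiv.apply_symm_apply]
        exact (Submodule.mem_dualAnnihilator φ).1 hφ f hf
      rw [h0]
      exact N.zero_mem
    intro f hf
    have hf' : f ∈ A.dualAnnihilator.dualCoannihilator := by
      rw [Submodule.mem_dualCoannihilator] at hf ⊢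
      exact fun φ hφ => hf φ (hle hφ)
    rwa [Subspace.dualAnnihilator_dualCoannihilator_eq] at hf'
  -- so the coannihilator is `⊥`, and `W.map e` is everything by the dimension formula
  have hcoann_bot : (W.map (e : (Y₀ → ℚ) →ₗ[ℚ] Module.Dual ℚ (Y₀ → ℚ))).dualCoannihilator = ⊥ := by
    rw [← hQbot, hQdef]
    exact (inf_eq_left.2 hcoann_le).symm
  have hdim := Subspace.finrank_add_finrank_dualCoannihilator_eq
    (W.map (e : (Y₀ → ℚ) →ₗ[ℚ] Module.Dual ℚ (Y₀ → ℚ)))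
  rw [hcoann_bot, finrank_bot, add_zero] at hdim
  have hWtop : W = ⊤ := by
    have hmap : W.map (e : (Y₀ → ℚ) →ₗ[ℚ] Module.Dual ℚ (Y₀ → ℚ)) = ⊤ :=
      Submodule.eq_top_of_finrank_eq (by rw [Subspace.dual_finrank_eq]; exact hdim)
    have := congrArg (Submodule.comap (e : (Y₀ → ℚ) →ₗ[ℚ] Module.Dual ℚ (Y₀ → ℚ))) hmap
    rwa [Submodule.comap_map_eq_of_injective e.injective, Submodule.comap_top] at this
  -- conclude: `S(w) = range Ψ = Ψ(W) ≤ N`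
  refine le_antisymm hN ?_
  rw [← hrange]
  rintro _ ⟨β, rfl⟩
  have hβ : β ∈ W := by rw [hWtop]; exact Submodule.mem_top
  exact hβ

/-! ### §2 One-sided quantisation against any right-stable partner space -/

omit [DecidableEq Y₀] in
/-- **ONE-SIDED QUANTISATION**: `A` stable irreducible, `w ∈ A`, `M ≤ ℚ^G` ANY right-stable subspace ⟹
`dim(S(w) ∩ M) = 0` or `= dim A`. [cite: Serre1977, §2.2 and §2.6] [cite: Gordon1999HodgeAVSurvey, §3 Theorem (proof)] -/
theorem finrank_span_shadowCoeff_inf_eq_zero_or_eq_of_rightStable {A : Submodule ℚ (Y₀ → ℚ)}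
    (hAst : ∀ (k : G) (a : Y₀ → ℚ), a ∈ A → (fun y => a (k • y)) ∈ A)
    (hirr : ∀ W : Submodule ℚ (Y₀ → ℚ), W ≤ A → W ≠ ⊥ →
      (∀ (k : G) (f : Y₀ → ℚ), f ∈ W → (fun y => f (k • y)) ∈ W) → W = A)
    {w : Y₀ → ℚ} (hw : w ∈ A) {M : Submodule ℚ (G → ℚ)}
    (hMst : ∀ (k : G) (c : G → ℚ), c ∈ M → (fun g => c (g * k)) ∈ M) :
    Module.finrank ℚ (Submodule.span ℚ (Set.range fun y : Y₀ => fun g : G => w (g • y)) ⊓ M :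
        Submodule ℚ (G → ℚ)) = 0 ∨
      Module.finrank ℚ (Submodule.span ℚ (Set.range fun y : Y₀ => fun g : G => w (g • y)) ⊓ M :
        Submodule ℚ (G → ℚ)) = Module.finrank ℚ A := by
  rcases eq_bot_or_eq_of_rightStable hAst hirr hw (N := Submodule.span ℚ (Set.range fun y : Y₀ => fun g : G =>
      w (g • y)) ⊓ M) inf_le_left
      (fun k c hc => ⟨translate_shadowCoeff_mem w k hc.1, hMst k c hc.2⟩) with h | h
  · left
    rw [h, finrank_bot]
  · by_cases hw0 : w = 0
    · left
      rw [(span_shadowCoeff_eq_bot_iff (G := G) w).2 hw0, bot_inf_eq, finrank_bot]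
    · right
      rw [h, finrank_span_shadowCoeff_eq_of_irreducible hAst hirr hw hw0]

omit [DecidableEq Y₀] in
/-- The non-zero case is ABSORPTION `S(w) ≤ M` (`w ≠ 0`). [cite: Serre1977, §2.2] -/
theorem span_shadowCoeff_inf_ne_bot_iff_le_of_rightStable {A : Submodule ℚ (Y₀ → ℚ)}
    (hAst : ∀ (k : G) (a : Y₀ → ℚ), a ∈ A → (fun y => a (k • y)) ∈ A)
    (hirr : ∀ W : Submodule ℚ (Y₀ → ℚ), W ≤ A → W ≠ ⊥ →
      (∀ (k : G) (f : Y₀ → ℚ), f ∈ W → (fun y => f (k • y)) ∈ W) → W = A)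
    {w : Y₀ → ℚ} (hw : w ∈ A) (hw0 : w ≠ 0) {M : Submodule ℚ (G → ℚ)}
    (hMst : ∀ (k : G) (c : G → ℚ), c ∈ M → (fun g => c (g * k)) ∈ M) :
    Submodule.span ℚ (Set.range fun y : Y₀ => fun g : G => w (g • y)) ⊓ M ≠ ⊥ ↔
      Submodule.span ℚ (Set.range fun y : Y₀ => fun g : G => w (g • y)) ≤ M := by
  constructor
  · intro hne
    rcases eq_bot_or_eq_of_rightStable hAst hirr hw (N := Submodule.span ℚ (Set.range fun y : Y₀ => fun g : G =>
        w (g • y)) ⊓ M) inf_le_left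
        (fun k c hc => ⟨translate_shadowCoeff_mem w k hc.1, hMst k c hc.2⟩) with h | h
    · exact absurd h hne
    · exact inf_eq_left.1 h
  · intro hle hbot
    rw [inf_eq_left.2 hle] at hbot
    exact hw0 ((span_shadowCoeff_eq_bot_iff (G := G) w).1 hbot)

variable {X : Type v''} [MulAction G X]

omit [MulAction G Y₀] [Fintype Y₀] [DecidableEq Y₀] in
/-- The matrix-coefficient space `MC(Φ) = span{g ↦ u_g(x)}` of ANY type on ANY slot is right-stable
(`u_{gk}(x) = u_g(k·x)`). [cite: Serre1977, §2.2] -/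
theorem span_coeff_rightStable (Φ : Set X) (k : G) {c : G → ℚ}
    (hc : c ∈ Submodule.span ℚ (Set.range fun x : X => fun g : G => antiVec Φ g x)) :
    (fun g => c (g * k)) ∈ Submodule.span ℚ (Set.range fun x : X => fun g : G => antiVec Φ g x) := by
  have hmap := (Submodule.map_span_le (LinearMap.funLeft ℚ ℚ (fun g : G => g * k))
    (Set.range fun x : X => fun g : G => antiVec Φ g x)
    (Submodule.span ℚ (Set.range fun x : X => fun g : G => antiVec Φ g x))).2 (by
      rintro _ ⟨x, rfl⟩
      refine Submodule.subset_span ⟨k • x, funext fun g => ?_⟩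
      simp [LinearMap.funLeft_apply, antiVec, translateInd, mul_smul])
  exact hmap (Submodule.mem_map_of_mem hc)

/-! ### §3 Type ranks: one irreducible shadow module against an arbitrary partner -/

variable {I : Type u} {E : I → Type v} [∀ i, MulAction G (E i)] [∀ i, Fintype (E i)] [Fintype I] [∀ i, Nonempty (E i)]

/-- **ONE-SIDED DEFECT QUANTISATION.**  Slot `i₀` with an equivariant pivot `r₀ : E_{i₀} → Y₀` refining the trace classes
of the partner, shadow `w₀(y) = Σ_{r₀ x = y} u₀(x)` in a stable IRREDUCIBLE module `A ≤ ℚ^{Y₀}`; the partner slot `i₁` is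
ARBITRARY.  Then `rank Φ₀ + rank Φ₁ = rank(Φ₀,Φ₁) + 1` (additive) or `= rank(Φ₀,Φ₁) + 1 + dim A` (absorbed).
[cite: Gordon1999HodgeAVSurvey, §3 Theorem, 7.5–7.7 and 9.4.3] [cite: Serre1977, §2.6] -/
theorem typeRank_add_typeRank_eq_or_eq_add_finrank_of_irreducible_left {ρ : G} {Φ : ∀ i, Set (E i)}
    (h : ∀ i, IsCMTypeWith ρ (Φ i)) {i₀ i₁ : I} (hI : ∀ j, j = i₀ ∨ j = i₁) (h01 : i₀ ≠ i₁)
    (r₀ : E i₀ → Y₀) (hr₀ : ∀ (g : G) (x : E i₀), r₀ (g • x) = g • r₀ x)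
    (hfine₀ : ∀ x x' : E i₀, r₀ x = r₀ x' → ∃ n : G, (∀ y : E i₁, n • y = y) ∧ n • x = x')
    {A : Submodule ℚ (Y₀ → ℚ)}
    (hAst : ∀ (k : G) (a : Y₀ → ℚ), a ∈ A → (fun y => a (k • y)) ∈ A)
    (hirr : ∀ W : Submodule ℚ (Y₀ → ℚ), W ≤ A → W ≠ ⊥ →
      (∀ (k : G) (f : Y₀ → ℚ), f ∈ W → (fun y => f (k • y)) ∈ W) → W = A)
    (hw₀A : (fun y : Y₀ => ∑ x ∈ Finset.univ.filter (fun x => r₀ x = y), antiVec (Φ i₀) (1 : G) x) ∈ A) :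
    typeRank G (Φ i₀) + typeRank G (Φ i₁) = typeRank G (sigmaType Φ) + 1 ∨
      typeRank G (Φ i₀) + typeRank G (Φ i₁) = typeRank G (sigmaType Φ) + 1 + Module.finrank ℚ A := by
  have hpair := typeRank_add_typeRank_eq_add_finrank_shadowCoeff_inf_of_fine h hI h01 r₀ hr₀ hfine₀
  have key := finrank_span_shadowCoeff_inf_eq_zero_or_eq_of_rightStable (G := G) hAst hirr hw₀A
    (M := Submodule.span ℚ (Set.range fun x : E i₁ => fun g : G => antiVec (Φ i₁) g x))
    (fun k c hc => span_coeff_rightStable (Φ i₁) k hc)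
  beta_reduce at key
  rcases key with h0 | hA
  · left
    rw [h0, add_zero] at hpair
    exact hpair
  · right
    rw [hA] at hpair
    exact hpair

/-- **ABSORPTION CRITERION**: under the same hypotheses and `w₀ ≠ 0`, the defect is `dim A` IFF `S(w₀) ≤ MC₁` (every
shadow coefficient of slot `i₀` is a matrix coefficient of the partner), and `0` otherwise.
[cite: Gordon1999HodgeAVSurvey, §3 Theorem, 7.5–7.7] [cite: Serre1977, §2.2] -/
theorem typeRank_add_typeRank_ne_iff_le_of_irreducible_left {ρ : G} {Φ : ∀ i, Set (E i)}
    (h : ∀ i, IsCMTypeWith ρ (Φ i)) {i₀ i₁ : I} (hI : ∀ j, j = i₀ ∨ j = i₁) (h01 : i₀ ≠ i₁)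
    (r₀ : E i₀ → Y₀) (hr₀ : ∀ (g : G) (x : E i₀), r₀ (g • x) = g • r₀ x)
    (hfine₀ : ∀ x x' : E i₀, r₀ x = r₀ x' → ∃ n : G, (∀ y : E i₁, n • y = y) ∧ n • x = x')
    {A : Submodule ℚ (Y₀ → ℚ)}
    (hAst : ∀ (k : G) (a : Y₀ → ℚ), a ∈ A → (fun y => a (k • y)) ∈ A)
    (hirr : ∀ W : Submodule ℚ (Y₀ → ℚ), W ≤ A → W ≠ ⊥ →
      (∀ (k : G) (f : Y₀ → ℚ), f ∈ W → (fun y => f (k • y)) ∈ W) → W = A)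
    (hw₀A : (fun y : Y₀ => ∑ x ∈ Finset.univ.filter (fun x => r₀ x = y), antiVec (Φ i₀) (1 : G) x) ∈ A)
    (hw₀ : (fun y : Y₀ => ∑ x ∈ Finset.univ.filter (fun x => r₀ x = y), antiVec (Φ i₀) (1 : G) x) ≠ 0) :
    typeRank G (Φ i₀) + typeRank G (Φ i₁) ≠ typeRank G (sigmaType Φ) + 1 ↔
      Submodule.span ℚ (Set.range fun y : Y₀ => fun g : G =>
          ∑ x ∈ Finset.univ.filter (fun x => r₀ x = g • y), antiVec (Φ i₀) (1 : G) x) ≤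
        Submodule.span ℚ (Set.range fun x : E i₁ => fun g : G => antiVec (Φ i₁) g x) := by
  have hpair := typeRank_add_typeRank_eq_add_finrank_shadowCoeff_inf_of_fine h hI h01 r₀ hr₀ hfine₀
  have key := span_shadowCoeff_inf_ne_bot_iff_le_of_rightStable (G := G) hAst hirr hw₀A hw₀
    (M := Submodule.span ℚ (Set.range fun x : E i₁ => fun g : G => antiVec (Φ i₁) g x))
    (fun k c hc => span_coeff_rightStable (Φ i₁) k hc)
  beta_reduce at key
  rw [← key]
  haveI : FiniteDimensional ℚ (Submodule.span ℚ (Set.range fun y : Y₀ => fun g : G =>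
      ∑ x ∈ Finset.univ.filter (fun x => r₀ x = g • y), antiVec (Φ i₀) (1 : G) x)) :=
    FiniteDimensional.span_of_finite ℚ (Set.finite_range _)
  rw [Ne, Ne, ← Submodule.finrank_eq_zero]
  omega

end Summit.HodgeConjecture.CorCM.IrrOdd

end
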